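import Summits.CriticalPhenomena.PercolationContinuityZ3.Theorems.Transplant.GrigorchukTimesZGrowthScope
import Summits.CriticalPhenomena.PercolationContinuityZ3.Theorems.Transplant.GrigorchukResidueScope
import Summits.CriticalPhenomena.PercolationContinuityZ3.Theorems.Transplant.BoxProdSubexponential
import HarnessLib

/-!
# `Cay(𝔊 × ℤ; a, b, c, d, z)` lies INSIDE THE SCOPE of the open residue node `BenjaminiSchramm1996_conj4_amenableSubexponential` — all five of its
# hypotheses are kernel for this graph (connected, quasi-transitive, amenable, NOT of exponential growth, `p_c < 1`); the node itself stays a HYPOTHESIS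

builds on p205010 (kernel theorem, internal audit signed; external expert review pending) — nothing in this file uses p205010.  Lane `prim-bschramm`, seat
`prim-bschramm-p3` gen 39 (DESIGN OWNER; `P3-NILPOTENT.md` §32.7, item O20 — the `𝔊 × ℤ` twin of «GrigorchukResidueScope» p625451).  Helper file
(`--supports stmt-CriticalPhenomena-4575 --as helper`).  One def (`gzBoxHom`), no instance, no notation; CUSTOMER ONLY of the residue node, which is taken as a
HYPOTHESIS binder (OPEN in print and in the tree; MUST-NOT 'closed').  `θ(p_c)` on this graph is NOT proved in tree or print; nothing about
`BenjaminiSchramm1996_conj4_endState`; no growth exponent.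

CONTENT (removes the 'pen by transfer' qualifier of VERDICTS :445 for the second witness of :439): the map `(g, m) ↦ (g, m)` is an injective graph homomorphism
`Cay(𝔊 × ℤ; a,b,c,d,z) →g Cay(𝔊; a,b,c,d) □ ℤ¹` (`gzBoxHom`), so exponential growth of `gzCay` would force exponential growth of the box product, against
«BoxProdSubexponential» `not_hasExponentialGrowth_boxProd_zdGraph` fed with Grigorchuk's upper bound p613200 `not_hasExponentialGrowth_cayley_gens`:
**`gzCay_not_hasExponentialGrowth`**; hence **`gzCay_isGraphAmenable`** (Lyons–Peres §6.1 contrapositive `hasExponentialGrowth_of_not_isGraphAmenable`, quasi-transitivity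
of a Cayley graph); `gzCay_connected` (from `closure_gzGens`), `gzCay_isQuasiTransitive`; **`gzCay_criticalProb_lt_one`** (𝔊 embeds: p607347's
`criticalProb_lt_one_of_grigorchukGroup_hom`, Muchnik–Pak kernel); and the customer **`gz_theta_eq_zero_of_conj4_amenableSubexponential`**.
[cite: BenjaminiSchramm1996, Conj. 4] [cite: Grigorchuk1984, Thm. (upper bound)] [cite: LyonsPeres2016, §6.1 (p. 279)] [cite: MuchnikPak2001, Thm. 1]
-/

noncomputable section

namespace Summit.CriticalPhenomena.PercolationContinuityZ3.Theorems.Transplant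

namespace Grigorchuk

open SimpleGraph Literature.Barriers.CriticalPhenomena Literature.Probability.Percolation Literature.Probability.LatticeModels
open scoped Classical

/-! ### §12 The embedding into `Cay(𝔊; a, b, c, d) □ ℤ¹` and subexponential growth -/

/-- The `ℤ`-coordinate as a site of `ℤ¹`. [folklore] -/
theorem site1_succ (m : Multiplicative ℤ) :
    (fun _ : Fin 1 => Multiplicative.toAdd (m * Multiplicative.ofAdd 1)) = (fun _ : Fin 1 => Multiplicative.toAdd m) + Pi.single (0 : Fin 1) (1 : ℤ) := by
  funext i
  rw [Subsingleton.elim i 0, Pi.add_apply, Pi.single_eq_same, toAdd_mul, toAdd_ofAdd]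

/-- **The injective graph homomorphism `Cay(𝔊 × ℤ; a,b,c,d,z) →g Cay(𝔊; a,b,c,d) □ ℤ¹`**, `(g, m) ↦ (g, m)`. [cite: BenjaminiSchramm1996, §2 (Cayley graphs)] -/
def gzBoxHom : gzCay →g stdCay □ zdGraph 1 where
  toFun x := (x.1, fun _ => Multiplicative.toAdd x.2)
  map_rel' {u w} h := by
    obtain ⟨y, rfl⟩ := gzCay_adj_iff.1 h
    rw [boxProd_adj]
    -- tree letters and `a`: a step in the first factor
    have htree : ∀ ℓ : Letter, stdCay.Adj u.1 (u * (Letter.toG ℓ, (1 : Multiplicative ℤ))).1 ∧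
        (fun _ : Fin 1 => Multiplicative.toAdd u.2) = (fun _ : Fin 1 => Multiplicative.toAdd (u * (Letter.toG ℓ, (1 : Multiplicative ℤ))).2) :=
      fun ℓ => ⟨by rw [Prod.fst_mul]; exact stdCay_adj_mul u.1 ℓ, by rw [Prod.snd_mul, mul_one]⟩
    rcases y with _ | _ | _ | _ | _ | _
    · exact Or.inl (htree .a)
    · exact Or.inl (htree (.x .b))
    · exact Or.inl (htree (.x .c))
    · exact Or.inl (htree (.x .d))
    · -- `z`: a step `+1` in the second factor
      refine Or.inr ⟨?_, ?_⟩
      · change (zdGraph 1).Adj (fun _ : Fin 1 => Multiplicative.toAdd u.2) (fun _ : Fin 1 => Multiplicative.toAdd (u * zP).2)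
        rw [Prod.snd_mul]
        exact (zdGraph_adj_iff _ _).2 ⟨0, Or.inl (site1_succ u.2)⟩
      · change u.1 = (u * zP).1
        rw [Prod.fst_mul]; exact (mul_one _).symm
    · -- `z⁻¹`: a step `−1` in the second factor
      refine Or.inr ⟨?_, ?_⟩
      · change (zdGraph 1).Adj (fun _ : Fin 1 => Multiplicative.toAdd u.2) (fun _ : Fin 1 => Multiplicative.toAdd (u * zP⁻¹).2)
        have e : u.2 = (u * zP⁻¹).2 * Multiplicative.ofAdd 1 := by
          rw [Prod.snd_mul, zP, Prod.inv_mk, inv_one, mul_assoc, inv_mul_cancel, mul_one]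
        refine (zdGraph_adj_iff _ _).2 ⟨0, Or.inr ?_⟩
        conv_lhs => rw [e]
        exact site1_succ _
      · change u.1 = (u * zP⁻¹).1
        rw [Prod.fst_mul, zP, Prod.inv_mk, inv_one]; exact (mul_one _).symm

/-- The embedding is injective. [folklore] -/
theorem gzBoxHom_injective : Function.Injective gzBoxHom := by
  rintro ⟨g, m⟩ ⟨g', m'⟩ h
  obtain ⟨h1, h2⟩ := Prod.ext_iff.1 h
  have h2' : Multiplicative.toAdd m = Multiplicative.toAdd m' := congrFun h2 0
  exact Prod.ext h1 (Multiplicative.toAdd.injective h2')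

/-- **`Cay(𝔊 × ℤ; a, b, c, d, z)` does NOT have exponential growth — kernel** (Grigorchuk's upper bound for `𝔊` passes to `Cay(𝔊) □ ℤ¹`, into which `gzCay` embeds).
No growth exponent is typed. [cite: Grigorchuk1984, Thm. (upper bound)] [cite: LyonsPeres2016, §6.1] -/
theorem gzCay_not_hasExponentialGrowth : ¬ HasExponentialGrowth gzCay := by
  intro h
  refine not_hasExponentialGrowth_boxProd_zdGraph stdCay 1 (not_hasExponentialGrowth_cayley_gens _) fun y => ?_
  -- every vertex of the box product is in the image of the embedding
  obtain ⟨g, v⟩ := y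
  obtain ⟨c, hc, hev⟩ := h (g, Multiplicative.ofAdd (v 0))
  refine ⟨c, hc, ?_⟩
  filter_upwards [hev] with n hn
  have hle := ballVolume_le_of_hom_injective gzBoxHom gzBoxHom_injective (g, Multiplicative.ofAdd (v 0)) n
  have e : gzBoxHom (g, Multiplicative.ofAdd (v 0)) = (g, v) := by
    refine Prod.ext rfl (funext fun i => ?_)
    rw [Subsingleton.elim i 0]; exact toAdd_ofAdd _
  rw [e] at hle
  exact hn.trans (by exact_mod_cast hle)

/-! ### §13 The five hypotheses of the residue node, and the customer -/

/-- `Cay(𝔊 × ℤ; a, b, c, d, z)` is connected. [cite: BenjaminiSchramm1996, §2 (Cayley graphs)] -/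
theorem gzCay_connected : gzCay.Connected := CayleyScaled.connected_mulCayley_of_closure gzGens closure_gzGens

/-- `Cay(𝔊 × ℤ; a, b, c, d, z)` is quasi-transitive (indeed transitive). [cite: BenjaminiSchramm1996, §2 (Cayley graphs)] -/
theorem gzCay_isQuasiTransitive : IsQuasiTransitive gzCay := CayleyScaled.isQuasiTransitive_mulCayley gzGens

/-- **`Cay(𝔊 × ℤ; a, b, c, d, z)` is AMENABLE — kernel** (a nonamenable quasi-transitive graph grows exponentially, Lyons–Peres §6.1). [cite: LyonsPeres2016, §6.1 (p. 279)] -/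
theorem gzCay_isGraphAmenable : IsGraphAmenable gzCay := by
  by_contra hna
  exact gzCay_not_hasExponentialGrowth (hasExponentialGrowth_of_not_isGraphAmenable _ gzCay_isQuasiTransitive hna)

/-- **`p_c(Cay(𝔊 × ℤ; a, b, c, d, z)) < 1` at every vertex — kernel** (`𝔊 ↪ 𝔊 × ℤ`; Muchnik–Pak for `𝔊`, p607347). [cite: MuchnikPak2001, Thm. 1] -/
theorem gzCay_criticalProb_lt_one (x : GZ) : criticalProb gzCay x < 1 :=
  criticalProb_lt_one_of_grigorchukGroup_hom gzGens closure_gzGens (MonoidHom.inl ↥grigorchukGroup (Multiplicative ℤ))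
    (fun _ _ h => (Prod.ext_iff.1 h).1) x

/-- **SCOPE OF THE RESIDUE NODE FOR `𝔊 × ℤ`: on `Cay(𝔊 × ℤ; a, b, c, d, z)` the open residue node — a HYPOTHESIS, never asserted — would give `θ_x(p_c) = 0` at every
vertex; its five hypotheses are the kernel theorems of this file.**  `θ(p_c)` itself is NOT proved; with «GrigorchukTimesZNoInput» / «…GrowthScope» no node or route of the
lane supplies it for any group of automorphisms. [cite: BenjaminiSchramm1996, Conj. 4] [cite: HermonHutchcroft2021, §1 (the open regime)] -/
theorem gz_theta_eq_zero_of_conj4_amenableSubexponential (h : BenjaminiSchramm1996_conj4_amenableSubexponential) (x : GZ) :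
    theta gzCay x (criticalProbIOf gzCay x) = 0 :=
  h _ gzCay_connected gzCay_isQuasiTransitive gzCay_isGraphAmenable gzCay_not_hasExponentialGrowth x (gzCay_criticalProb_lt_one x)

end Grigorchuk

end Summit.CriticalPhenomena.PercolationContinuityZ3.Theorems.Transplant
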